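import Literature.NumberTheory.LFunctions.DedekindGammaFactorDerivatives
import Literature.NumberTheory.LFunctions.DeuringHeilbronnBounds
import Literature.NumberTheory.LFunctions.RayClassFunctionalEquation
import HarnessLib

/-!
# Higher derivatives of `L_∞'/L_∞` for the Gamma factor `L_∞(χ, s) = ∏_{v real} Γ_ℝ(s + p_v) ∏_{v complex} Γ_ℂ(s)`
# of a Hecke `L`-function with sign type

Topic `Literature/NumberTheory/LFunctions` (namespace `Literature.NumberTheory.LFunctions`), the ray-class
counterpart (sign type `p`, shifts `p_v ∈ {0,1}` at the real places) of the tree's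
`DedekindGammaFactorDerivatives.lean` / `DeuringHeilbronnBounds.exists_re_pole_gamma_le` (`p = ∅`).  Everything
here is PROVED; `realShift` and `trivMult` are definitions with bodies.

For the Gamma factor `L_∞ = rayClassGammaFactor K p` of a ray class character of sign type `p`:
* `logDeriv_rayClassGammaFactor_of_re_pos` — on `Re s > 0`:
  `L_∞'/L_∞(s) = Σ_{v real} Γ_ℝ'/Γ_ℝ(s + p_v) + r₂ Γ_ℂ'/Γ_ℂ(s)`;
* `hasSum_iteratedDeriv_logDeriv_rayClassGammaFactor` — for `Re s > 0`, `k ≥ 1`: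
  `(L_∞'/L_∞)^{(k)}(s) = (−1)^{k+1} k! Σ_{j ≥ 0} a_j (s + j)^{−(k+1)}`, where
  `a_j = #{v real : p_v ≡ j (mod 2)} + r₂` (`trivMult`) is the multiplicity of the trivial zero `−j` of
  `L(s, χ)` [cite: ThornerZaman2017, §2 (2.4)] ("ord_{s=ω} L(s,χ) = a(χ) [ω = 0, −2, −4, …], b(χ) [ω = −1, −3, …]";
  here with the complex places counted in both, `Γ_ℂ(s) = Γ_ℝ(s)Γ_ℝ(s+1)` up to constants);
* `exists_re_logDeriv_rayClassGammaFactor_le` — an absolute `A₀ ≥ 0` with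
  `Re 2L_∞'/L_∞(2 + it) ≤ n_K (A₀ + 2 log(|t| + 2))` for every `K`, `p`, `t` (Stirling for `ψ` on the vertical lines
  `Re = 1, 3/2, 2`) [cite: ThornerZaman2017, Lemma 7.4] (the archimedean part of the `M`-bound).

## References
* J. Thorner, A. Zaman, Algebra Number Theory 11 (2017), §2 (2.2)–(2.4), Lemma 7.3–7.4. [ThornerZaman2017]
* G. E. Andrews, R. Askey, R. Roy, *Special Functions*, CUP 1999, Thm. 1.2.5. [AndrewsAskeyRoy1999]
-/

noncomputable section

open scoped NumberField Real Classical
open NumberField NumberField.InfinitePlace Complex Filter Topology Finset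

namespace Literature.NumberTheory.LFunctions

open Literature.NumberTheory.LFunctions.NumberField
open Literature.Analysis.SpecialFunctions.Complex (hasSum_iteratedDeriv_digamma
  hasSum_iteratedDeriv_digamma_half differentiableOn_digamma)

variable {K : Type*} [Field K] [NumberField K]
variable (p : Finset {w : InfinitePlace K // IsReal w})

/-! ### The shifts `p_v ∈ {0, 1}` -/

/-- The shift `p_v = 2 · halfWeight ∈ {0, 1}` of the real place `v` (`1` iff `v ∈ p`).
[cite: ThornerZaman2017, §2 (2.2)] -/
def realShift (w : {w : InfinitePlace K // IsReal w}) : ℕ := if w ∈ p then 1 else 0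

omit [NumberField K] in
/-- `2 · halfWeight = p_v`. [cite: ThornerZaman2017, §2 (2.2)] -/
theorem two_mul_halfWeight_eq (w : {w : InfinitePlace K // IsReal w}) :
    (2 : ℂ) * (NumberField.halfWeight K p w.1 : ℂ) = (realShift p w : ℂ) := by
  unfold NumberField.halfWeight realShift
  rw [dif_pos w.2]
  by_cases hw : w ∈ p
  · simp [hw]
  · simp [hw]

omit [NumberField K] in
/-- `p_v ≤ 1`. [cite: ThornerZaman2017, §2 (2.2)] -/
theorem realShift_le_one (w : {w : InfinitePlace K // IsReal w}) : realShift p w ≤ 1 := by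
  unfold realShift; split_ifs <;> norm_num

/-- The Gamma factor with the shifts written as natural numbers. [cite: ThornerZaman2017, §2 (2.2)] -/
theorem rayClassGammaFactor_eq_prod_realShift :
    rayClassGammaFactor K p = fun s ↦
      (∏ w : {w : InfinitePlace K // IsReal w}, Gammaℝ (s + (realShift p w : ℂ))) *
        ∏ _w : {w : InfinitePlace K // IsComplex w}, Gammaℂ s := by
  classical
  funext s
  rw [rayClassGammaFactor]
  congr 1
  exact Finset.prod_congr rfl fun w _ ↦ by rw [two_mul_halfWeight_eq]

/-! ### The logarithmic derivative on `Re s > 0` -/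

/-- `Γ_ℝ(· + c)` is differentiable and non-zero at `s` when `Re s > 0`, `c ≥ 0`. [folklore] -/
private theorem gammaℝ_shift_differentiableAt {s : ℂ} (hs : 0 < s.re) (c : ℕ) :
    DifferentiableAt ℂ (fun z : ℂ ↦ Gammaℝ (z + c)) s ∧ Gammaℝ (s + c) ≠ 0 ∧
      DifferentiableAt ℂ Gammaℝ (s + c) := by
  have hsc : 0 < (s + (c : ℂ)).re := by simp; positivity
  have h2 : ∀ m : ℕ, (s + (c : ℂ)) / 2 ≠ -m := fun m h ↦ by
    have := congrArg Complex.re h; simp at this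
    linarith [(c.cast_nonneg : (0 : ℝ) ≤ c), (m.cast_nonneg : (0 : ℝ) ≤ m)]
  have hd : DifferentiableAt ℂ Gammaℝ (s + c) := (RealZeros.hasDerivAt_Gammaℝ h2).differentiableAt
  exact ⟨hd.comp s (differentiableAt_id.add_const _), Gammaℝ_ne_zero_of_re_pos hsc, hd⟩

/-- `Γ_ℂ` is differentiable and non-zero at `s` when `Re s > 0`. [folklore] -/
private theorem gammaℂ_differentiableAt {s : ℂ} (hs : 0 < s.re) :
    DifferentiableAt ℂ Gammaℂ s ∧ Gammaℂ s ≠ 0 := by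
  have hsN : ∀ m : ℕ, s ≠ -m := ne_neg_nat_of_re_pos hs
  refine ⟨differentiableAt_Gammaℂ hsN, ?_⟩
  rw [Gammaℂ_def]
  refine mul_ne_zero (mul_ne_zero two_ne_zero ?_) (Complex.Gamma_ne_zero hsN)
  rw [Ne, Complex.cpow_eq_zero_iff]
  exact fun h ↦ (mul_ne_zero two_ne_zero (by exact_mod_cast Real.pi_ne_zero)) h.1

/-- **`L_∞'/L_∞(s) = Σ_{v real} Γ_ℝ'/Γ_ℝ(s + p_v) + r₂ Γ_ℂ'/Γ_ℂ(s)`** on `Re s > 0`.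
[cite: ThornerZaman2017, §2 Lemma 2.1] -/
theorem logDeriv_rayClassGammaFactor_of_re_pos {s : ℂ} (hs : 0 < s.re) :
    logDeriv (rayClassGammaFactor K p) s =
      ∑ w : {w : InfinitePlace K // IsReal w}, logDeriv Gammaℝ (s + (realShift p w : ℂ)) +
        (nrComplexPlaces K : ℂ) * logDeriv Gammaℂ s := by
  obtain ⟨hℂd, hℂ0⟩ := gammaℂ_differentiableAt hs
  have hR := fun w : {w : InfinitePlace K // IsReal w} ↦ gammaℝ_shift_differentiableAt hs (realShift p w)
  rw [rayClassGammaFactor_eq_prod_realShift,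
    logDeriv_mul (f := fun z ↦ ∏ w : {w : InfinitePlace K // IsReal w}, Gammaℝ (z + (realShift p w : ℂ)))
      (g := fun z ↦ ∏ _w : {w : InfinitePlace K // IsComplex w}, Gammaℂ z) s
      (prod_ne_zero_iff.2 fun w _ ↦ (hR w).2.1) (prod_ne_zero_iff.2 fun _ _ ↦ hℂ0)
      (DifferentiableAt.fun_finsetProd fun w _ ↦ (hR w).1) (DifferentiableAt.fun_finsetProd fun _ _ ↦ hℂd),
    logDeriv_prod (s := univ) (f := fun (w : {w : InfinitePlace K // IsReal w}) (z : ℂ) ↦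
        Gammaℝ (z + (realShift p w : ℂ))) (x := s) (fun w _ ↦ (hR w).2.1) (fun w _ ↦ (hR w).1),
    logDeriv_prod (s := univ) (f := fun (_w : {w : InfinitePlace K // IsComplex w}) (z : ℂ) ↦ Gammaℂ z) (x := s)
      (fun _ _ ↦ hℂ0) (fun _ _ ↦ hℂd)]
  rw [Finset.sum_const, Finset.card_univ, nrComplexPlaces, nsmul_eq_mul]
  congr 1
  refine sum_congr rfl fun w _ ↦ ?_
  rw [logDeriv_apply, logDeriv_apply, deriv_comp_add_const]

/-! ### The multiplicities of the trivial zeros and the higher derivatives -/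

variable (K) in
/-- The multiplicity `a_j` of the trivial zero `−j` of `L(s, χ)` for a character of sign type `p`:
`#{v real : p_v ≡ j (mod 2)} + r₂`. [cite: ThornerZaman2017, §2 (2.4)] -/
def trivMult (j : ℕ) : ℕ :=
  (if Even j then (Finset.univ.filter (fun w : {w : InfinitePlace K // IsReal w} ↦ w ∉ p)).card else p.card) +
    nrComplexPlaces K

/-- `a_j ≤ n_K`. [cite: ThornerZaman2017, §2 (2.3)] -/
theorem trivMult_le (j : ℕ) : trivMult K p j ≤ Module.finrank ℚ K := by
  have h := card_add_two_mul_card_eq_rank K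
  have h1 : (Finset.univ.filter (fun w : {w : InfinitePlace K // IsReal w} ↦ w ∉ p)).card ≤ nrRealPlaces K := by
    rw [nrRealPlaces, ← Finset.card_univ]; exact Finset.card_le_card (Finset.filter_subset _ _)
  have h2 : p.card ≤ nrRealPlaces K := by
    rw [nrRealPlaces, ← Finset.card_univ]; exact Finset.card_le_card (Finset.subset_univ _)
  unfold trivMult
  rw [nrRealPlaces, nrComplexPlaces] at *
  split_ifs <;> omega

/-- Summability of `Σ_j |s + j|^{−m}`, `Re s > 0`, `m ≥ 2`. [folklore] -/
private theorem summable_norm_inv_pow_add_nat' {s : ℂ} (hs : 0 < s.re) {m : ℕ} (hm : 2 ≤ m) :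
    Summable fun j : ℕ ↦ ‖((s + j) ^ m)⁻¹‖ := by
  rw [← summable_nat_add_iff 1]
  have hb : Summable fun j : ℕ ↦ 1 / ((j : ℝ) + 1) ^ 2 :=
    Literature.Analysis.SpecialFunctions.Complex.summable_one_div_nat_add_one_sq
  refine Summable.of_nonneg_of_le (fun j ↦ norm_nonneg _) (fun j ↦ ?_) hb
  have h1 : (j : ℝ) + 1 ≤ ‖s + ((j + 1 : ℕ) : ℂ)‖ := by
    have := abs_re_le_norm (s + ((j + 1 : ℕ) : ℂ))
    rw [add_re, natCast_re] at this
    have h2 : s.re + ((j + 1 : ℕ) : ℝ) ≤ |s.re + ((j + 1 : ℕ) : ℝ)| := le_abs_self _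
    push_cast at this h2 ⊢
    linarith
  have hpos : 0 < (j : ℝ) + 1 := by positivity
  rw [norm_inv, norm_pow, one_div]
  calc (‖s + ((j + 1 : ℕ) : ℂ)‖ ^ m)⁻¹ ≤ (((j : ℝ) + 1) ^ m)⁻¹ := by
        apply inv_anti₀ (by positivity)
        exact pow_le_pow_left₀ hpos.le h1 m
    _ ≤ (((j : ℝ) + 1) ^ 2)⁻¹ := by
        apply inv_anti₀ (by positivity)
        exact pow_le_pow_right₀ (by linarith) hm

/-- The terms `(s + c + 2j)^{−m}` re-indexed over all `j` with the parity of `j − c` (`c ∈ {0,1}`):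
`Σ_i (s + c + 2i)^{−m} = Σ_j [j ≡ c mod 2] (s + j)^{−m}`. [folklore] -/
private theorem hasSum_parity_trivial {s : ℂ} (hs : 0 < s.re) {m : ℕ} (hm : 2 ≤ m) (c : ℕ) (hc : c ≤ 1) :
    HasSum (fun j : ℕ ↦ if j % 2 = c then ((s + j) ^ m)⁻¹ else 0)
      (∑' i : ℕ, ((s + c + 2 * i) ^ m)⁻¹) ∧ Summable fun i : ℕ ↦ ((s + (c : ℂ) + 2 * (i : ℂ)) ^ m)⁻¹ := by
  have hS := Summable.of_norm (summable_norm_inv_pow_add_nat' hs hm)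
  set g : ℕ → ℕ := fun i ↦ c + 2 * i with hg
  have hinj : Function.Injective g := fun a b h ↦ by simp [hg] at h; exact h
  have h2 : Summable fun i : ℕ ↦ ((s + (c : ℂ) + 2 * (i : ℂ)) ^ m)⁻¹ := by
    refine (hS.comp_injective hinj).congr fun i ↦ ?_
    simp only [Function.comp_apply, hg]; push_cast; ring_nf
  refine ⟨?_, h2⟩
  have h3 := (hasSum_extend_zero hinj).mpr h2.hasSum
  refine h3.congr_fun fun j ↦ ?_
  by_cases hj : j % 2 = c
  · have hnat : c + 2 * ((j - c) / 2) = j := by omega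
    have hjg : j = g ((j - c) / 2) := by simp only [hg]; omega
    rw [if_pos hj]
    conv_rhs => rw [hjg]
    rw [hinj.extend_apply]
    congr 2
    rw [add_assoc]
    congr 1
    exact_mod_cast hnat.symm
  · rw [if_neg hj, Function.extend_apply']
    · rfl
    · rintro ⟨i, rfl⟩; exact hj (by simp [hg]; omega)

/-- **Higher derivatives of `L_∞'/L_∞`**: for `Re s > 0` and `k ≥ 1`,
`(L_∞'/L_∞)^{(k)}(s) = (−1)^{k+1} k! Σ_{j≥0} a_j (s + j)^{−(k+1)}` with `a_j = trivMult K p j`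
(the trivial zeros `−j` of `L(s,χ)` with multiplicity). [cite: ThornerZaman2017, §2 (2.4) and Lemma 2.2] -/
theorem hasSum_iteratedDeriv_logDeriv_rayClassGammaFactor {s : ℂ} (hs : 0 < s.re) {k : ℕ} (hk : 1 ≤ k) :
    HasSum (fun j : ℕ ↦ (-1) ^ (k + 1) * (k.factorial : ℂ) * (trivMult K p j : ℂ) * ((s + j) ^ (k + 1))⁻¹)
      (iteratedDeriv k (logDeriv (rayClassGammaFactor K p)) s) := by
  have hU : IsOpen {w : ℂ | 0 < w.re} := isOpen_lt continuous_const continuous_re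
  have hk0 : 0 < k := hk
  have hm : 2 ≤ k + 1 := by omega
  -- Step A: the logarithmic derivative near `s`
  have hev : logDeriv (rayClassGammaFactor K p) =ᶠ[𝓝 s] fun z ↦
      ∑ w : {w : InfinitePlace K // IsReal w}, logDeriv Gammaℝ (z + (realShift p w : ℂ)) +
        (nrComplexPlaces K : ℂ) * logDeriv Gammaℂ z := by
    filter_upwards [hU.mem_nhds hs] with z hz
    exact logDeriv_rayClassGammaFactor_of_re_pos p hz
  -- smoothness of the pieces
  have hψ : ∀ c : ℕ, ContDiffAt ℂ k (fun z : ℂ ↦ logDeriv Gammaℝ (z + c)) s := by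
    intro c
    have hsc : 0 < (s + (c : ℂ)).re := by simp; positivity
    have hev' : (fun z : ℂ ↦ logDeriv Gammaℝ (z + c)) =ᶠ[𝓝 s]
        fun z ↦ -(Complex.log π) / 2 + digamma ((z + c) / 2) / 2 := by
      filter_upwards [hU.mem_nhds hs] with z hz
      have h2 : ∀ m : ℕ, (z + (c : ℂ)) / 2 ≠ -m := fun m h ↦ by
        have := congrArg Complex.re h; simp at this
        have hz' : 0 < z.re := hz
        linarith [(m.cast_nonneg : (0 : ℝ) ≤ m), (c.cast_nonneg : (0 : ℝ) ≤ c)]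
      exact LFunctions.logDeriv_Gammaℝ h2
    refine ContDiffAt.congr_of_eventuallyEq ?_ hev'
    have h1 : ContDiffAt ℂ k (fun z : ℂ ↦ digamma (z / 2) / 2) (s + c) := contDiffAt_digamma_half hsc k
    have h2 : ContDiffAt ℂ k (fun z : ℂ ↦ digamma ((z + c) / 2) / 2) s :=
      h1.comp s (contDiffAt_id.add contDiffAt_const)
    exact contDiffAt_const.add h2
  have hψℂ : ContDiffAt ℂ k (logDeriv Gammaℂ) s := by
    have hev' : logDeriv Gammaℂ =ᶠ[𝓝 s] fun z ↦ -Complex.log (2 * π) + digamma z := by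
      filter_upwards [hU.mem_nhds hs] with z hz
      exact logDeriv_Gammaℂ (ne_neg_nat_of_re_pos hz)
    exact (contDiffAt_const.add (contDiffAt_digamma hs k)).congr_of_eventuallyEq hev'
  -- Step B: differentiate the sum
  rw [hev.iteratedDeriv_eq,
    iteratedDeriv_fun_add (ContDiffAt.sum fun w _ ↦ hψ (realShift p w)) (contDiffAt_const.mul hψℂ),
    iteratedDeriv_fun_sum fun w _ ↦ hψ (realShift p w), iteratedDeriv_const_mul _ hψℂ]
  -- Step C: each piece
  have hreal : ∀ c : ℕ, HasSum (fun i : ℕ ↦ (-1) ^ (k + 1) * (k.factorial : ℂ) * ((s + c + 2 * i) ^ (k + 1))⁻¹)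
      (iteratedDeriv k (fun z : ℂ ↦ logDeriv Gammaℝ (z + c)) s) := by
    intro c
    have hsc : 0 < (s + (c : ℂ)).re := by simp; positivity
    rw [iteratedDeriv_comp_add_const k (logDeriv Gammaℝ) (c : ℂ)]
    simp only []
    have hev' : logDeriv Gammaℝ =ᶠ[𝓝 (s + c)] fun z ↦ -(Complex.log π) / 2 + digamma (z / 2) / 2 := by
      filter_upwards [hU.mem_nhds hsc] with z hz
      have h2 : ∀ m : ℕ, z / 2 ≠ -m := fun m h ↦ by
        have := congrArg Complex.re h; simp at this
        have hz' : 0 < z.re := hz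
        linarith [(m.cast_nonneg : (0 : ℝ) ≤ m)]
      exact LFunctions.logDeriv_Gammaℝ h2
    rw [hev'.iteratedDeriv_eq, iteratedDeriv_const_add hk0]
    exact hasSum_iteratedDeriv_digamma_half hsc hk
  have hcplx : HasSum (fun j : ℕ ↦ (-1) ^ (k + 1) * (k.factorial : ℂ) * ((s + j) ^ (k + 1))⁻¹)
      (iteratedDeriv k (logDeriv Gammaℂ) s) := by
    have hev' : logDeriv Gammaℂ =ᶠ[𝓝 s] fun z ↦ -Complex.log (2 * π) + digamma z := by
      filter_upwards [hU.mem_nhds hs] with z hz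
      exact logDeriv_Gammaℂ (ne_neg_nat_of_re_pos hz)
    rw [hev'.iteratedDeriv_eq, iteratedDeriv_const_add hk0]
    exact hasSum_iteratedDeriv_digamma hs hk
  -- Step D: regroup by the node `−j`
  have hreal' : ∀ w : {w : InfinitePlace K // IsReal w},
      HasSum (fun j : ℕ ↦ (-1) ^ (k + 1) * (k.factorial : ℂ) *
        ((if j % 2 = realShift p w then ((s + j) ^ (k + 1))⁻¹ else 0)))
        (iteratedDeriv k (fun z : ℂ ↦ logDeriv Gammaℝ (z + (realShift p w : ℂ))) s) := by
    intro w
    obtain ⟨hpar, -⟩ := hasSum_parity_trivial hs hm (realShift p w) (realShift_le_one p w)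
    have h1 := hpar.mul_left ((-1) ^ (k + 1) * (k.factorial : ℂ))
    have h2 := hreal (realShift p w)
    have hval : (-1) ^ (k + 1) * (k.factorial : ℂ) * ∑' i : ℕ, ((s + (realShift p w : ℂ) + 2 * i) ^ (k + 1))⁻¹ =
        iteratedDeriv k (fun z : ℂ ↦ logDeriv Gammaℝ (z + (realShift p w : ℂ))) s := by
      rw [← h2.tsum_eq, tsum_mul_left]
    rw [← hval]
    exact h1
  have hsumR := hasSum_sum (s := (univ : Finset {w : InfinitePlace K // IsReal w})) fun w _ ↦ hreal' w
  have hC := hcplx.mul_left (nrComplexPlaces K : ℂ)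
  refine (hsumR.add hC).congr_fun fun j ↦ ?_
  -- the coefficient of `(s + j)^{−(k+1)}`
  have hcount : (∑ w : {w : InfinitePlace K // IsReal w},
      (if j % 2 = realShift p w then ((s + j) ^ (k + 1))⁻¹ else (0 : ℂ))) =
      ((if Even j then (Finset.univ.filter (fun w : {w : InfinitePlace K // IsReal w} ↦ w ∉ p)).card else p.card : ℕ) : ℂ) *
        ((s + j) ^ (k + 1))⁻¹ := by
    rw [← Finset.sum_filter, Finset.sum_const, nsmul_eq_mul]
    congr 2
    by_cases hj : Even j
    · rw [if_pos hj]
      congr 1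
      ext w
      simp only [mem_filter, mem_univ, true_and, realShift]
      have : j % 2 = 0 := Nat.even_iff.mp hj
      split_ifs with hw <;> simp [hw, this]
    · rw [if_neg hj]
      have : j % 2 = 1 := Nat.odd_iff.mp (Nat.not_even_iff_odd.mp hj)
      congr 1
      ext w
      simp only [mem_filter, mem_univ, true_and, realShift]
      split_ifs with hw <;> simp [hw, this]
  rw [← Finset.mul_sum, hcount, trivMult]
  push_cast
  ring

/-! ### The archimedean part of the `M`-bound -/

/-- **The archimedean part of the `M`-bound, with sign type**: there is an absolute `A₀ ≥ 0` such that for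
every number field `K`, every sign type `p` and real `t`, at `s = 2 + it`,
`Re[2 L_∞'/L_∞(s)] ≤ n_K (A₀ + 2 log(|t| + 2))`. [cite: ThornerZaman2017, Lemma 7.4] -/
theorem exists_re_logDeriv_rayClassGammaFactor_le :
    ∃ A₀ : ℝ, 0 ≤ A₀ ∧ ∀ (K : Type*) [Field K] [NumberField K] (p : Finset {w : InfinitePlace K // IsReal w}) (t : ℝ),
      (2 * logDeriv (rayClassGammaFactor K p) (2 + t * I)).re ≤
        Module.finrank ℚ K * (A₀ + 2 * Real.log (|t| + 2)) := by
  obtain ⟨C₁, hC₁⟩ := Literature.Analysis.SpecialFunctions.Complex.exists_norm_digamma_vertical_le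
    (a := 1) one_pos
  obtain ⟨C₃, hC₃⟩ := Literature.Analysis.SpecialFunctions.Complex.exists_norm_digamma_vertical_le
    (a := 3 / 2) (by norm_num)
  obtain ⟨C₂, hC₂⟩ := Literature.Analysis.SpecialFunctions.Complex.exists_norm_digamma_vertical_le
    (a := 2) two_pos
  have hC₁0 : 0 ≤ C₁ := by have := (norm_nonneg _).trans (hC₁ 0); simpa using this
  have hC₃0 : 0 ≤ C₃ := by have := (norm_nonneg _).trans (hC₃ 0); simpa using this
  have hC₂0 : 0 ≤ C₂ := by have := (norm_nonneg _).trans (hC₂ 0); simpa using this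
  set Lπ : ℝ := ‖Complex.log π‖ with hLπ
  set L2π : ℝ := ‖Complex.log (2 * π)‖ with hL2π
  refine ⟨2 * (Lπ + L2π + C₁ + C₂ + C₃), by positivity, fun K _ _ p t ↦ ?_⟩
  set s : ℂ := 2 + t * I with hs
  have hsre : s.re = 2 := by simp [hs]
  have hs0 : 0 < s.re := by rw [hsre]; norm_num
  -- digamma bounds
  have hlog : 0 ≤ Real.log (|t| + 2) := Real.log_nonneg (by linarith [abs_nonneg t])
  have hψ : ∀ c : ℕ, c ≤ 1 → ‖digamma ((s + c) / 2)‖ ≤ (C₁ + C₃) + Real.log (|t| + 2) := by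
    intro c hc
    have ht2 : |t / 2| ≤ |t| := by rw [abs_div, abs_two]; linarith [abs_nonneg t]
    have hl := DH.log_one_add_le ht2
    interval_cases c
    · have : (s + (0 : ℕ)) / 2 = (1 : ℝ) + (t / 2 : ℝ) * I := by simp [hs]; ring
      rw [this]
      linarith [hC₁ (t / 2)]
    · have : (s + (1 : ℕ)) / 2 = ((3 / 2 : ℝ) : ℂ) + (t / 2 : ℝ) * I := by simp [hs]; ring
      rw [this]
      linarith [hC₃ (t / 2)]
  have hψ2 : ‖digamma s‖ ≤ C₂ + Real.log (|t| + 2) := by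
    have : s = (2 : ℝ) + t * I := by simp [hs]
    rw [this]
    exact (hC₂ t).trans (by linarith [DH.log_one_add_le (le_refl |t|)])
  -- the real and complex factors
  have hRn : ∀ w : {w : InfinitePlace K // IsReal w},
      ‖logDeriv Gammaℝ (s + (realShift p w : ℂ))‖ ≤ Lπ + C₁ + C₃ + Real.log (|t| + 2) := by
    intro w
    have h2 : ∀ m : ℕ, (s + (realShift p w : ℂ)) / 2 ≠ -m := fun m h ↦ by
      have := congrArg Complex.re h; simp [hs] at this
      linarith [(m.cast_nonneg : (0 : ℝ) ≤ m), ((realShift p w).cast_nonneg : (0 : ℝ) ≤ realShift p w)]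
    rw [LFunctions.logDeriv_Gammaℝ h2]
    calc ‖-Complex.log π / 2 + digamma ((s + (realShift p w : ℂ)) / 2) / 2‖
        ≤ ‖-Complex.log π / 2‖ + ‖digamma ((s + (realShift p w : ℂ)) / 2) / 2‖ := norm_add_le _ _
      _ = Lπ / 2 + ‖digamma ((s + (realShift p w : ℂ)) / 2)‖ / 2 := by
          rw [norm_div, norm_neg, norm_div]; simp [hLπ]
      _ ≤ Lπ + C₁ + C₃ + Real.log (|t| + 2) := by
          have := hψ (realShift p w) (realShift_le_one p w)
          have : 0 ≤ Lπ := norm_nonneg _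
          linarith
  have hCn : ‖logDeriv Gammaℂ s‖ ≤ L2π + C₂ + Real.log (|t| + 2) := by
    rw [logDeriv_Gammaℂ (ne_neg_nat_of_re_pos hs0)]
    calc ‖-Complex.log (2 * π) + digamma s‖ ≤ ‖-Complex.log (2 * π)‖ + ‖digamma s‖ := norm_add_le _ _
      _ ≤ L2π + C₂ + Real.log (|t| + 2) := by rw [norm_neg, ← hL2π]; linarith
  -- assemble
  rw [logDeriv_rayClassGammaFactor_of_re_pos p hs0]
  have h2 : ∀ z : ℂ, ((2 : ℂ) * z).re = 2 * z.re := fun z ↦ by simp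
  rw [h2, add_re, re_sum]
  have e1 : ∑ w : {w : InfinitePlace K // IsReal w}, (logDeriv Gammaℝ (s + (realShift p w : ℂ))).re ≤
      nrRealPlaces K * (Lπ + C₁ + C₃ + Real.log (|t| + 2)) := by
    calc ∑ w : {w : InfinitePlace K // IsReal w}, (logDeriv Gammaℝ (s + (realShift p w : ℂ))).re
        ≤ ∑ _w : {w : InfinitePlace K // IsReal w}, (Lπ + C₁ + C₃ + Real.log (|t| + 2)) :=
          sum_le_sum fun w _ ↦ (re_le_norm _).trans (hRn w)
      _ = nrRealPlaces K * (Lπ + C₁ + C₃ + Real.log (|t| + 2)) := by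
          rw [sum_const, card_univ, nrRealPlaces, nsmul_eq_mul]
  have e2 : ((nrComplexPlaces K : ℂ) * logDeriv Gammaℂ s).re ≤ nrComplexPlaces K * (L2π + C₂ + Real.log (|t| + 2)) := by
    calc ((nrComplexPlaces K : ℂ) * logDeriv Gammaℂ s).re ≤ ‖(nrComplexPlaces K : ℂ) * logDeriv Gammaℂ s‖ := re_le_norm _
      _ = (nrComplexPlaces K : ℝ) * ‖logDeriv Gammaℂ s‖ := by rw [norm_mul]; simp
      _ ≤ nrComplexPlaces K * (L2π + C₂ + Real.log (|t| + 2)) := by gcongr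
  have hn : (nrRealPlaces K : ℝ) + nrComplexPlaces K ≤ Module.finrank ℚ K := by
    have h := card_add_two_mul_card_eq_rank K
    have : nrRealPlaces K + nrComplexPlaces K ≤ Module.finrank ℚ K := by
      rw [nrRealPlaces, nrComplexPlaces] at *; omega
    exact_mod_cast this
  have hr1 : (0 : ℝ) ≤ nrRealPlaces K := Nat.cast_nonneg _
  have hr2 : (0 : ℝ) ≤ nrComplexPlaces K := Nat.cast_nonneg _
  have hLπ0 : 0 ≤ Lπ := norm_nonneg _
  have hL2π0 : 0 ≤ L2π := norm_nonneg _
  set L : ℝ := Real.log (|t| + 2) with hL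
  have e3 : (nrRealPlaces K : ℝ) * (Lπ + C₁ + C₃ + L) ≤ nrRealPlaces K * (Lπ + L2π + C₁ + C₂ + C₃ + L) :=
    mul_le_mul_of_nonneg_left (by linarith) hr1
  have e4 : (nrComplexPlaces K : ℝ) * (L2π + C₂ + L) ≤ nrComplexPlaces K * (Lπ + L2π + C₁ + C₂ + C₃ + L) :=
    mul_le_mul_of_nonneg_left (by linarith) hr2
  have e5 : ((nrRealPlaces K : ℝ) + nrComplexPlaces K) * (Lπ + L2π + C₁ + C₂ + C₃ + L) ≤
      Module.finrank ℚ K * (Lπ + L2π + C₁ + C₂ + C₃ + L) :=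
    mul_le_mul_of_nonneg_right hn (by positivity)
  nlinarith [e1, e2, e3, e4, e5]

/-- **Pole + conductor + Gamma part of the `M`-bound**: with the absolute `A₀` of
`exists_re_logDeriv_rayClassGammaFactor_le`, for `A ≥ 1`, at `s = 2 + it`:
`Re[2/s + 2/(s−1) + log A + 2L_∞'/L_∞(s)] ≤ 3 + log A + n_K(A₀ + 2 log(|t| + 2))`.
[cite: ThornerZaman2017, Lemma 7.4] -/
theorem exists_re_pole_cond_gamma_le :
    ∃ A₀ : ℝ, 0 ≤ A₀ ∧ ∀ (K : Type*) [Field K] [NumberField K] (p : Finset {w : InfinitePlace K // IsReal w})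
      (A : ℝ), 1 ≤ A → ∀ t : ℝ,
      ((2 : ℂ) / (2 + t * I) + 2 / (2 + t * I - 1) + (Real.log A : ℂ) +
          2 * logDeriv (rayClassGammaFactor K p) (2 + t * I)).re ≤
        3 + Real.log A + Module.finrank ℚ K * (A₀ + 2 * Real.log (|t| + 2)) := by
  obtain ⟨A₀, hA₀, h⟩ := exists_re_logDeriv_rayClassGammaFactor_le
  refine ⟨A₀, hA₀, fun K _ _ p A hA t ↦ ?_⟩
  have h1 := h K p t
  have h2 := DH.re_two_div_add_le t
  rw [add_re, add_re, Complex.ofReal_re]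
  linarith

end Literature.NumberTheory.LFunctions

end
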